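import Summits.KontsevichZagierPeriods.KontsevichZagierPeriods.Theses.AttractorUnfolding

/-!
# Crux `FibrewiseResidue` (stmt-KontsevichZagierPeriods-11361) — skeleton line `birth`

Route: route-KontsevichZagierPeriods-AttractorUnfolding (E2, the 2πi-carrier).

The crux says: over a ℚ-semialgebraic base `τ`, the representation
`[τ × ℝ, Re(a(x) · w′(t)/(w(t) − p(x)))]` (Cayley parametrisation `w = c + s(1+it)/(1−it)` of the
fibre circle `|w − c(x)| = s(x)`, pole `p(x)` INSIDE) is KZ-equivalent to the arctangent carrier
`[τ × ℝ, −2·Im a(x)/(1+t²)]`.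

Skeleton = the ℂ-linearity split of the Cauchy kernel `W = w′/(w − p)` into its LOG PART
`Re W = ∂ₜ log|w − p|` and its ARG PART `Im W = ∂ₜ arg(w − p)`:
`Re(a·W) = Re a · Re W − Im a · Im W` (rule 1b, integrand additivity, proved here), and
* `stub_piecesRep`     — the two pieces ARE integral representations over `τ × ℝ`
                          (semialgebraicity of the pieces; integrability: `Im W > 0` with
                          `∫_ℝ Im W dt = 2π`, Tonelli against `r'`; the log piece is `r + (arg piece)`);
* `stub_logPartCancels` — `[τ × ℝ, Re a(x) · Re W] ∈ KZ.relations` (value 0: the signed image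
                          cells of `u = |w − p|²` cancel on the monotonicity cells of a ℚ-CAD);
* `stub_argPartCovers`  — `[τ × ℝ, −Im a(x) · Im W] ~ [τ × ℝ, −2 Im a(x)/(1+t²)]` (value
                          `−2π ∫_τ Im a`: the cells of `u = Im(w−p)/Re(w−p)` cover `ℝ_u` twice —
                          the winding-number / DegreeTransfer instance with parameters).
Each main stub is the crux specialised to a REAL resp. PURELY IMAGINARY coefficient `a`; neither
gives the crux back (the other half is missing), and `FibrewiseResidue_of` re-assembles them by
one instance of move (1b) and subgroup arithmetic.
-/

set_option linter.dupNamespace false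

namespace Summit.KontsevichZagierPeriods.KontsevichZagierPeriods.Cruxes.FibrewiseResidue.Birth

open Set

/-- PIECES ARE REPRESENTATIONS: given the crux data (and the two crux representations `r`, `r'`,
whose integrability is what makes the pieces integrable), the log piece
`z ↦ Re a(x) · Re W(z)` and the (negated) arg piece `z ↦ −Im a(x) · Im W(z)` are integrands of
integral representations over `τ × ℝ` (ℚ-semialgebraic on the domain, absolutely integrable). -/
theorem stub_piecesRep :
    ∀ (n : ℕ) (τ : Set (Fin n → ℝ)) (c p a : (Fin n → ℝ) → ℂ) (s : (Fin n → ℝ) → ℝ) (r r' : Literature.NumberTheory.Transcendental.KZ.IntegralRep (n + 1)), Literature.ModelTheory.ExponentialFields.IsSemialgebraic ℚ τ → Literature.NumberTheory.Transcendental.IsSemialgebraicFunOn ℚ τ (fun x => (c x).re) → Literature.NumberTheory.Transcendental.IsSemialgebraicFunOn ℚ τ (fun x => (c x).im) → Literature.NumberTheory.Transcendental.IsSemialgebraicFunOn ℚ τ (fun x => (p x).re) → Literature.NumberTheory.Transcendental.IsSemialgebraicFunOn ℚ τ (fun x => (p x).im) → Literature.NumberTheory.Transcendental.IsSemialgebraicFunOn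 ℚ τ (fun x => (a x).re) → Literature.NumberTheory.Transcendental.IsSemialgebraicFunOn ℚ τ (fun x => (a x).im) → Literature.NumberTheory.Transcendental.IsSemialgebraicFunOn ℚ τ s → (∀ x ∈ τ, ‖p x - c x‖ < s x) → r.domain = {z | (Fin.init z : Fin n → ℝ) ∈ τ} → r'.domain = {z | (Fin.init z : Fin n → ℝ) ∈ τ} → Set.EqOn r.integrand (fun z => (a (Fin.init z) * (2 * Complex.I * (s (Fin.init z) : ℂ) / (1 - (z (Fin.last n) : ℂ) * Complex.I) ^ 2) / ((c (Fin.init z) + (s (Fin.init z) : ℂ) * (1 + (z (Fin.last n) : ℂ) * Complex.I) / (1 - (z (Fin.last n) : ℂ) * Complex.I)) - p (Fin.init z))).re) r.domain → Set.EqOn r'.integrand (fun z => -2 * (a (Fin.init z)).im / (1 + z (Fin.last n) ^ 2)) r'.domain → ∃ r₁ r₂ : Literature.NumberTheory.Transcendental.KZ.IntegralRep (n + 1), r₁.domain = {z | (Fin.init z : Fin n → ℝ) ∈ τ} ∧ r₂.domain = {z | (Fin.init z : Fin n → ℝ) ∈ τ} ∧ Set.EqOn r₁.integrand (fun z => (a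 (Fin.init z)).re * ((2 * Complex.I * (s (Fin.init z) : ℂ) / (1 - (z (Fin.last n) : ℂ) * Complex.I) ^ 2) / ((c (Fin.init z) + (s (Fin.init z) : ℂ) * (1 + (z (Fin.last n) : ℂ) * Complex.I) / (1 - (z (Fin.last n) : ℂ) * Complex.I)) - p (Fin.init z))).re) r₁.domain ∧ Set.EqOn r₂.integrand (fun z => -((a (Fin.init z)).im * ((2 * Complex.I * (s (Fin.init z) : ℂ) / (1 - (z (Fin.last n) : ℂ) * Complex.I) ^ 2) / ((c (Fin.init z) + (s (Fin.init z) : ℂ) * (1 + (z (Fin.last n) : ℂ) * Complex.I) / (1 - (z (Fin.last n) : ℂ) * Complex.I)) - p (Fin.init z))).im)) r₂.domain := by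
  sorry

/-- LOG PART CANCELS: `[τ × ℝ, Re a(x) · Re(w′/(w − p))]` is a relation of the KZ calculus
(value `∫_τ Re a(x) · [log|w − p|]` between `t = −∞` and `t = +∞`, i.e. `0`; suggested chain:
ℚ-CAD of `τ × ℝ` adapted to the sign of `∂ₜ|w − p|²`, rule 2 with `u = |w − p|²` on each
monotonicity cell, signed cancellation of the image cells by rule 1a). -/
theorem stub_logPartCancels :
    ∀ (n : ℕ) (τ : Set (Fin n → ℝ)) (c p a : (Fin n → ℝ) → ℂ) (s : (Fin n → ℝ) → ℝ) (r₁ : Literature.NumberTheory.Transcendental.KZ.IntegralRep (n + 1)), Literature.ModelTheory.ExponentialFields.IsSemialgebraic ℚ τ → Literature.NumberTheory.Transcendental.IsSemialgebraicFunOn ℚ τ (fun x => (c x).re) → Literature.NumberTheory.Transcendental.IsSemialgebraicFunOn ℚ τ (fun x => (c x).im) → Literature.NumberTheory.Transcendental.IsSemialgebraicFunOn ℚ τ (fun x => (p x).re) → Literature.NumberTheory.Transcendental.IsSemialgebraicFunOn ℚ τ (fun x => (p x).im) → Literature.NumberTheory.Transcendental.IsSemialgebraicFunOn ℚ τ (fun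 x => (a x).re) → Literature.NumberTheory.Transcendental.IsSemialgebraicFunOn ℚ τ (fun x => (a x).im) → Literature.NumberTheory.Transcendental.IsSemialgebraicFunOn ℚ τ s → (∀ x ∈ τ, ‖p x - c x‖ < s x) → r₁.domain = {z | (Fin.init z : Fin n → ℝ) ∈ τ} → Set.EqOn r₁.integrand (fun z => (a (Fin.init z)).re * ((2 * Complex.I * (s (Fin.init z) : ℂ) / (1 - (z (Fin.last n) : ℂ) * Complex.I) ^ 2) / ((c (Fin.init z) + (s (Fin.init z) : ℂ) * (1 + (z (Fin.last n) : ℂ) * Complex.I) / (1 - (z (Fin.last n) : ℂ) * Complex.I)) - p (Fin.init z))).re) r₁.domain → Literature.NumberTheory.Transcendental.KZ.of r₁ ∈ Literature.NumberTheory.Transcendental.KZ.relations := by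
  sorry

/-- ARG PART COVERS: `[τ × ℝ, −Im a(x) · Im(w′/(w − p))] ~ [τ × ℝ, −2·Im a(x)/(1 + t²)]`
(both values `−2π ∫_τ Im a`; suggested chain: on the cells where `Re(w − p) ≠ 0`, rule 2 with
`u = Im(w − p)/Re(w − p)` turns `Im W dt` into `du/(1+u²)`; with the pole inside, the image cells
cover `ℝ_u` exactly twice (winding number 1), and `2·[τ × ℝ, Im a/(1+u²)]` is re-based to the
carrier by rule 1a). -/
theorem stub_argPartCovers :
    ∀ (n : ℕ) (τ : Set (Fin n → ℝ)) (c p a : (Fin n → ℝ) → ℂ) (s : (Fin n → ℝ) → ℝ) (r₂ r' : Literature.NumberTheory.Transcendental.KZ.IntegralRep (n + 1)), Literature.ModelTheory.ExponentialFields.IsSemialgebraic ℚ τ → Literature.NumberTheory.Transcendental.IsSemialgebraicFunOn ℚ τ (fun x => (c x).re) → Literature.NumberTheory.Transcendental.IsSemialgebraicFunOn ℚ τ (fun x => (c x).im) → Literature.NumberTheory.Transcendental.IsSemialgebraicFunOn ℚ τ (fun x => (p x).re) → Literature.NumberTheory.Transcendental.IsSemialgebraicFunOn ℚ τ (fun x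 => (p x).im) → Literature.NumberTheory.Transcendental.IsSemialgebraicFunOn ℚ τ (fun x => (a x).re) → Literature.NumberTheory.Transcendental.IsSemialgebraicFunOn ℚ τ (fun x => (a x).im) → Literature.NumberTheory.Transcendental.IsSemialgebraicFunOn ℚ τ s → (∀ x ∈ τ, ‖p x - c x‖ < s x) → r₂.domain = {z | (Fin.init z : Fin n → ℝ) ∈ τ} → r'.domain = {z | (Fin.init z : Fin n → ℝ) ∈ τ} → Set.EqOn r₂.integrand (fun z => -((a (Fin.init z)).im * ((2 * Complex.I * (s (Fin.init z) : ℂ) / (1 - (z (Fin.last n) : ℂ) * Complex.I) ^ 2) / ((c (Fin.init z) + (s (Fin.init z) : ℂ) * (1 + (z (Fin.last n) : ℂ) * Complex.I) / (1 - (z (Fin.last n) : ℂ) * Complex.I)) - p (Fin.init z))).im)) r₂.domain → Set.EqOn r'.integrand (fun z => -2 * (a (Fin.init z)).im / (1 + z (Fin.last n) ^ 2)) r'.domain → Literature.NumberTheory.Transcendental.KZ.Equivalent r₂ r' := by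
  sorry

/-- ASSEMBLY, arrow form (kernel-checked, no `sorry`): the three stub statements imply the crux statement
(conclusion = the crux signature UNFOLDED verbatim, so that exactly one theorem of this file,
`FibrewiseResidue_of`, concludes the crux by name — the shape `#h21_check_skeleton` keys on).
Proof: split `r` by integrand additivity (move 1b) into the two pieces delivered by
`stub_piecesRep` — pointwise `Re(a·N/D) = Re a · Re(N/D) − Im a · Im(N/D)` (`mul_div_assoc`,
`Complex.mul_re`) — then `[r] − [r'] = ([r] − [r₁] − [r₂]) + [r₁] + ([r₂] − [r'])` is a sum of
three relations. -/
theorem FibrewiseResidue_of_stubs :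
    (∀ (n : ℕ) (τ : Set (Fin n → ℝ)) (c p a : (Fin n → ℝ) → ℂ) (s : (Fin n → ℝ) → ℝ) (r r' : Literature.NumberTheory.Transcendental.KZ.IntegralRep (n + 1)), Literature.ModelTheory.ExponentialFields.IsSemialgebraic ℚ τ → Literature.NumberTheory.Transcendental.IsSemialgebraicFunOn ℚ τ (fun x => (c x).re) → Literature.NumberTheory.Transcendental.IsSemialgebraicFunOn ℚ τ (fun x => (c x).im) → Literature.NumberTheory.Transcendental.IsSemialgebraicFunOn ℚ τ (fun x => (p x).re) → Literature.NumberTheory.Transcendental.IsSemialgebraicFunOn ℚ τ (fun x => (p x).im) → Literature.NumberTheory.Transcendental.IsSemialgebraicFunOn ℚ τ (fun x => (a x).re) → Literature.NumberTheory.Transcendental.IsSemialgebraicFunOn ℚ τ (fun x => (a x).im) → Literature.NumberTheory.Transcendental.IsSemialgebraicFunOn ℚ τ s → (∀ x ∈ τ, ‖p x - c x‖ < s x) → r.domain = {z | (Fin.init z : Fin n → ℝ) ∈ τ} → r'.domain = {z | (Fin.init z : Fin n → ℝ) ∈ τ} → Set.EqOn r.integrand (fun z => (a (Fin.init z) * (2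 * Complex.I * (s (Fin.init z) : ℂ) / (1 - (z (Fin.last n) : ℂ) * Complex.I) ^ 2) / ((c (Fin.init z) + (s (Fin.init z) : ℂ) * (1 + (z (Fin.last n) : ℂ) * Complex.I) / (1 - (z (Fin.last n) : ℂ) * Complex.I)) - p (Fin.init z))).re) r.domain → Set.EqOn r'.integrand (fun z => -2 * (a (Fin.init z)).im / (1 + z (Fin.last n) ^ 2)) r'.domain → ∃ r₁ r₂ : Literature.NumberTheory.Transcendental.KZ.IntegralRep (n + 1), r₁.domain = {z | (Fin.init z : Fin n → ℝ) ∈ τ} ∧ r₂.domain = {z | (Fin.init z : Fin n → ℝ) ∈ τ} ∧ Set.EqOn r₁.integrand (fun z => (a (Fin.init z)).re * ((2 * Complex.I * (s (Fin.init z) : ℂ) / (1 - (z (Fin.last n) : ℂ) * Complex.I) ^ 2) / ((c (Fin.init z) + (s (Fin.init z) : ℂ) * (1 + (z (Fin.last n) : ℂ) * Complex.I) / (1 - (z (Fin.last n) : ℂ) * Complex.I)) - p (Fin.init z))).re) r₁.domain ∧ Set.EqOn r₂.integrand (fun z => -((a (Fin.init z)).im * ((2 * Complex.I * (s (Fin.init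 z) : ℂ) / (1 - (z (Fin.last n) : ℂ) * Complex.I) ^ 2) / ((c (Fin.init z) + (s (Fin.init z) : ℂ) * (1 + (z (Fin.last n) : ℂ) * Complex.I) / (1 - (z (Fin.last n) : ℂ) * Complex.I)) - p (Fin.init z))).im)) r₂.domain) →
    (∀ (n : ℕ) (τ : Set (Fin n → ℝ)) (c p a : (Fin n → ℝ) → ℂ) (s : (Fin n → ℝ) → ℝ) (r₁ : Literature.NumberTheory.Transcendental.KZ.IntegralRep (n + 1)), Literature.ModelTheory.ExponentialFields.IsSemialgebraic ℚ τ → Literature.NumberTheory.Transcendental.IsSemialgebraicFunOn ℚ τ (fun x => (c x).re) → Literature.NumberTheory.Transcendental.IsSemialgebraicFunOn ℚ τ (fun x => (c x).im) → Literature.NumberTheory.Transcendental.IsSemialgebraicFunOn ℚ τ (fun x => (p x).re) → Literature.NumberTheory.Transcendental.IsSemialgebraicFunOn ℚ τ (fun x => (p x).im) → Literature.NumberTheory.Transcendental.IsSemialgebraicFunOn ℚ τ (fun x => (a x).re) → Literature.NumberTheory.Transcendental.IsSemialgebraicFunOn ℚ τ (fun x => (a x).im) → Literature.NumberTheory.Transcendental.IsSemialgebraicFunOn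 ℚ τ s → (∀ x ∈ τ, ‖p x - c x‖ < s x) → r₁.domain = {z | (Fin.init z : Fin n → ℝ) ∈ τ} → Set.EqOn r₁.integrand (fun z => (a (Fin.init z)).re * ((2 * Complex.I * (s (Fin.init z) : ℂ) / (1 - (z (Fin.last n) : ℂ) * Complex.I) ^ 2) / ((c (Fin.init z) + (s (Fin.init z) : ℂ) * (1 + (z (Fin.last n) : ℂ) * Complex.I) / (1 - (z (Fin.last n) : ℂ) * Complex.I)) - p (Fin.init z))).re) r₁.domain → Literature.NumberTheory.Transcendental.KZ.of r₁ ∈ Literature.NumberTheory.Transcendental.KZ.relations) →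
    (∀ (n : ℕ) (τ : Set (Fin n → ℝ)) (c p a : (Fin n → ℝ) → ℂ) (s : (Fin n → ℝ) → ℝ) (r₂ r' : Literature.NumberTheory.Transcendental.KZ.IntegralRep (n + 1)), Literature.ModelTheory.ExponentialFields.IsSemialgebraic ℚ τ → Literature.NumberTheory.Transcendental.IsSemialgebraicFunOn ℚ τ (fun x => (c x).re) → Literature.NumberTheory.Transcendental.IsSemialgebraicFunOn ℚ τ (fun x => (c x).im) → Literature.NumberTheory.Transcendental.IsSemialgebraicFunOn ℚ τ (fun x => (p x).re) → Literature.NumberTheory.Transcendental.IsSemialgebraicFunOn ℚ τ (fun x => (p x).im) → Literature.NumberTheory.Transcendental.IsSemialgebraicFunOn ℚ τ (fun x => (a x).re) → Literature.NumberTheory.Transcendental.IsSemialgebraicFunOn ℚ τ (fun x => (a x).im) → Literature.NumberTheory.Transcendental.IsSemialgebraicFunOn ℚ τ s → (∀ x ∈ τ, ‖p x - c x‖ < s x) → r₂.domain = {z | (Fin.init z : Fin n → ℝ) ∈ τ} → r'.domain = {z | (Fin.init z : Fin n → ℝ) ∈ τ} → Set.EqOn r₂.integrand (fun z => -((a (Fin.init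 z)).im * ((2 * Complex.I * (s (Fin.init z) : ℂ) / (1 - (z (Fin.last n) : ℂ) * Complex.I) ^ 2) / ((c (Fin.init z) + (s (Fin.init z) : ℂ) * (1 + (z (Fin.last n) : ℂ) * Complex.I) / (1 - (z (Fin.last n) : ℂ) * Complex.I)) - p (Fin.init z))).im)) r₂.domain → Set.EqOn r'.integrand (fun z => -2 * (a (Fin.init z)).im / (1 + z (Fin.last n) ^ 2)) r'.domain → Literature.NumberTheory.Transcendental.KZ.Equivalent r₂ r') →
    ∀ (n : ℕ) (τ : Set (Fin n → ℝ)) (c p a : (Fin n → ℝ) → ℂ) (s : (Fin n → ℝ) → ℝ) (r r' : Literature.NumberTheory.Transcendental.KZ.IntegralRep (n + 1)), Literature.ModelTheory.ExponentialFields.IsSemialgebraic ℚ τ → Literature.NumberTheory.Transcendental.IsSemialgebraicFunOn ℚ τ (fun x => (c x).re) → Literature.NumberTheory.Transcendental.IsSemialgebraicFunOn ℚ τ (fun x => (c x).im) → Literature.NumberTheory.Transcendental.IsSemialgebraicFunOn ℚ τ (fun x => (p x).re) → Literature.NumberTheory.Transcendental.IsSemialgebraicFunOn ℚ τ (fun x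 => (p x).im) → Literature.NumberTheory.Transcendental.IsSemialgebraicFunOn ℚ τ (fun x => (a x).re) → Literature.NumberTheory.Transcendental.IsSemialgebraicFunOn ℚ τ (fun x => (a x).im) → Literature.NumberTheory.Transcendental.IsSemialgebraicFunOn ℚ τ s → (∀ x ∈ τ, ‖p x - c x‖ < s x) → r.domain = {z | (Fin.init z : Fin n → ℝ) ∈ τ} → r'.domain = {z | (Fin.init z : Fin n → ℝ) ∈ τ} → Set.EqOn r.integrand (fun z => (a (Fin.init z) * (2 * Complex.I * (s (Fin.init z) : ℂ) / (1 - (z (Fin.last n) : ℂ) * Complex.I) ^ 2) / ((c (Fin.init z) + (s (Fin.init z) : ℂ) * (1 + (z (Fin.last n) : ℂ) * Complex.I) / (1 - (z (Fin.last n) : ℂ) * Complex.I)) - p (Fin.init z))).re) r.domain → Set.EqOn r'.integrand (fun z => -2 * (a (Fin.init z)).im / (1 + z (Fin.last n) ^ 2)) r'.domain → Literature.NumberTheory.Transcendental.KZ.Equivalent r r' := by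
  intro hPieces hLog hArg n τ c p a s r r' hτ hc1 hc2 hp1 hp2 ha1 ha2 hs hin hdom hdom' hint hint'
  obtain ⟨r₁, r₂, hdom₁, hdom₂, hint₁, hint₂⟩ :=
    hPieces n τ c p a s r r' hτ hc1 hc2 hp1 hp2 ha1 ha2 hs hin hdom hdom' hint hint'
  have h₁ : Literature.NumberTheory.Transcendental.KZ.of r₁ ∈ Literature.NumberTheory.Transcendental.KZ.relations :=
    hLog n τ c p a s r₁ hτ hc1 hc2 hp1 hp2 ha1 ha2 hs hin hdom₁ hint₁
  have h₂ : Literature.NumberTheory.Transcendental.KZ.Equivalent r₂ r' :=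
    hArg n τ c p a s r₂ r' hτ hc1 hc2 hp1 hp2 ha1 ha2 hs hin hdom₂ hdom' hint₂ hint'
  -- move (1b): `[r] − [r₁] − [r₂]` is a relation
  have hsplit : Literature.NumberTheory.Transcendental.KZ.of r - Literature.NumberTheory.Transcendental.KZ.of r₁ - Literature.NumberTheory.Transcendental.KZ.of r₂ ∈ Literature.NumberTheory.Transcendental.KZ.relations := by
    refine Literature.NumberTheory.Transcendental.KZ.integrandAddRel_subset_relations ?_
    refine ⟨n + 1, r, r₁, r₂, by rw [hdom₁, hdom], by rw [hdom₂, hdom], ?_, rfl⟩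
    intro z hz
    have hz₁ : z ∈ r₁.domain := by rw [hdom₁]; rw [hdom] at hz; exact hz
    have hz₂ : z ∈ r₂.domain := by rw [hdom₂]; rw [hdom] at hz; exact hz
    rw [Pi.add_apply, hint hz, hint₁ hz₁, hint₂ hz₂]
    show (a (Fin.init z) * (2 * Complex.I * (s (Fin.init z) : ℂ) / (1 - (z (Fin.last n) : ℂ) * Complex.I) ^ 2) / ((c (Fin.init z) + (s (Fin.init z) : ℂ) * (1 + (z (Fin.last n) : ℂ) * Complex.I) / (1 - (z (Fin.last n) : ℂ) * Complex.I)) - p (Fin.init z))).re = (a (Fin.init z)).re * ((2 * Complex.I * (s (Fin.init z) : ℂ) / (1 - (z (Fin.last n) : ℂ) * Complex.I) ^ 2) / ((c (Fin.init z) + (s (Fin.init z) : ℂ) * (1 + (z (Fin.last n) : ℂ) * Complex.I) / (1 - (z (Fin.last n) : ℂ) * Complex.I)) - p (Fin.init z))).re + -((a (Fin.init z)).im * ((2 * Complex.I * (s (Fin.init z) : ℂ) / (1 - (z (Fin.last n) : ℂ) * Complex.I) ^ 2) / ((c (Fin.init z) + (s (Fin.init z) : ℂ) * (1 + (z (Fin.last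 n) : ℂ) * Complex.I) / (1 - (z (Fin.last n) : ℂ) * Complex.I)) - p (Fin.init z))).im)
    rw [mul_div_assoc, Complex.mul_re, sub_eq_add_neg]
  -- subgroup arithmetic
  have hsum := Literature.NumberTheory.Transcendental.KZ.relations.add_mem (Literature.NumberTheory.Transcendental.KZ.relations.add_mem hsplit h₁) h₂
  unfold Literature.NumberTheory.Transcendental.KZ.Equivalent at hsum ⊢
  convert hsum using 1
  abel

/-- **The skeleton theorem**: concludes the crux `FibrewiseResidue` BY NAME; `sorry` enters only
through the three named stubs `stub_piecesRep`, `stub_logPartCancels`, `stub_argPartCovers`. -/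
theorem FibrewiseResidue_of : Summit.KontsevichZagierPeriods.KontsevichZagierPeriods.Theses.AttractorUnfolding.FibrewiseResidue :=
  FibrewiseResidue_of_stubs stub_piecesRep stub_logPartCancels stub_argPartCovers

end Summit.KontsevichZagierPeriods.KontsevichZagierPeriods.Cruxes.FibrewiseResidue.Birth
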